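import Literature.NumberTheory.EllipticCurves.GrossPoints
import Mathlib.RingTheory.ClassGroup.Basic
import HarnessLib

/-!
# The action of `Pic(𝒪_c)` on Gross points (Bertolini–Darmon 1996, §2.3)

Second file of the definition item `defn-GrossPointsThetaElement` (sequel of
`Literature.NumberTheory.EllipticCurves.GrossPoints`). Bertolini–Darmon, *Heegner points on
Mumford–Tate curves*, Invent. Math. 126 (1996), §2.3:

> "Let `𝒪` be the order of `K` of conductor `c` … Let `Pic(𝒪) = Ôˣ \ K̂ˣ / Kˣ` be the Picard
> group of `𝒪`. If `f ∈ Hom(K, B)`, let `f̂ ∈ Hom(K̂, B̂)` be the homomorphism deduced from `f`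
> by extension of scalars. The set `H_N(K; c)` of all Heegner points `(g × f)` of conductor `c`
> is endowed with a natural action of `Pic(𝒪)` by the rule `σ(g × f) = (g f̂(σ) × f)` (4). The
> reader will check that this action is well-defined and free."

In the ideal-theoretic model of `GrossPoints.lean` (points `[(f, I)]`, `I` an invertible right
`O`-ideal, `f` optimal for `𝒪_c` into `O_L(I)`) the idèle `σ` corresponds to the invertible
fractional `𝒪_c`-ideal `𝔞_σ = σ Ô_c ∩ K` and (4) reads `𝔞 · [(f, I)] = [(f, f(𝔞) I)]`: the lattice
action of `GrossPoints.lean` restricted to invertible `𝒪_c`-ideals; principal ideals `(a)` act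
trivially (`[(f, f(a) I)] = [f(a) • (f, I)] = [(f, I)]`, as `f(a) ∈ Dˣ` commutes with `f(K)`), so
the action factors through `Pic(𝒪_c) =` Mathlib's `ClassGroup (quadOrder K c)` (invertible
fractional ideals modulo principal ones; `isFractionRing_quadOrder`).

## Contents

* `fracIdealLattice c 𝔞`: the `ℤ`-lattice of `K` underlying a fractional `𝒪_c`-ideal, with
  `fracIdealLattice_one = 𝒪_c`, `_mul`, `_spanSingleton`;
* `GrossSpace.IsSaturated c x`: `𝒪_c • x = x`, i.e. `[(f, f(𝒪_c) I)] = [(f, I)]` — automatic for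
  Gross points of conductor `c` (`isSaturated_of_mem_grossPoints`: optimality gives
  `f(𝒪_c) I = I`), and the locus on which unit ideals act by a *group* action;
* `GrossSpace.fracIdealUnitsSMul c`: the action of the group `(FractionalIdeal 𝒪_c⁰ K)ˣ` of
  invertible fractional `𝒪_c`-ideals on `GrossSpace D K`, `𝔞 • x = f(𝔞)-translate` on saturated
  `x` and — documented junk — the identity on non-saturated `x` (this makes the action total and
  lawful on the whole Gross space; it is never used off the saturated locus);
* `units_smul_eq_self_of_mem_range`: principal ideals act trivially;
* `GrossSpace.picardPermHom c : ClassGroup (quadOrder K c) →* Equiv.Perm (GrossSpace D K)` and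
  the resulting `MulAction (ClassGroup (quadOrder K c)) (GrossSpace D K)`
  (`GrossSpace.picardMulAction`, an instance), with the computation rule
  `picard_mk_smul_mk`: `[𝔞] • [(f, I)] = [(f, f(𝔞) I)]` for `𝔞` an invertible fractional ideal
  of `𝒪_c` in `K` and `[(f, I)]` saturated (BD96 (4)).

## What is NOT here

That `Pic(𝒪_c)` *preserves* `grossPoints K S c` (conductor exactly `c`, invertibility of
`f(𝔞) I`: BD96 §2.3 "the reader will check that this action is well-defined") is proved in the
sequel `GrossPointsPicardActionHeegner.lean` (`picard_smul_mem_grossPoints`); that the action is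
free and the count `#H(K, c) = 2^t · #Pic(𝒪_c)` (BD96 Lemma 2.5, Eichler's optimal-embedding
theory; Vignéras, LNM 800, Cor. III.5.12) are not treated. The theta elements of
`GrossPointsThetaElement.lean` only need the action itself.

## References

* [BertoliniDarmon1996] Bertolini–Darmon, Invent. Math. 126 (1996), §2.3 (4), Lemma 2.4–2.5.
* [Gross1987] Gross, *Heights and the special values of `L`-series* (1987), §3 (the action of
  `Pic(𝒪)` on special points, `x_𝔞`).
-/

noncomputable section

open scoped Pointwise nonZeroDivisors
open NumberField Literature.NumberTheory.Automorphic

universe u v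

namespace Literature.NumberTheory.EllipticCurves

variable {D : Type v} [Ring D] [Algebra ℚ D] {K : Type u} [Field K]

/-! ### Fractional `𝒪_c`-ideals as lattices of `K` -/

/-- The `ℤ`-lattice of `K` underlying a fractional ideal `𝔞` of the order `𝒪_c`
(restriction of scalars from `𝒪_c` to `ℤ`). [folklore] -/
def fracIdealLattice (c : ℕ) (𝔞 : FractionalIdeal (quadOrder K c)⁰ K) : Submodule ℤ K :=
  (𝔞 : Submodule (quadOrder K c) K).restrictScalars ℤ

/-- Membership in the underlying lattice is membership in the fractional ideal. [folklore] -/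
@[simp] theorem mem_fracIdealLattice_iff {c : ℕ} {𝔞 : FractionalIdeal (quadOrder K c)⁰ K}
    {x : K} : x ∈ fracIdealLattice c 𝔞 ↔ x ∈ 𝔞 :=
  Iff.rfl

/-- The lattice of `𝔞 𝔟` is the product of the lattices. [folklore] -/
theorem fracIdealLattice_mul (c : ℕ) (𝔞 𝔟 : FractionalIdeal (quadOrder K c)⁰ K) :
    fracIdealLattice c (𝔞 * 𝔟) = fracIdealLattice c 𝔞 * fracIdealLattice c 𝔟 := by
  rw [fracIdealLattice, FractionalIdeal.coe_mul, Submodule.restrictScalars_mul]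
  rfl

/-- The lattice of the unit ideal is `𝒪_c` itself. [folklore] -/
theorem fracIdealLattice_one (c : ℕ) :
    fracIdealLattice c (1 : FractionalIdeal (quadOrder K c)⁰ K) =
      Subalgebra.toSubmodule (quadOrder K c) := by
  ext x
  rw [mem_fracIdealLattice_iff, FractionalIdeal.mem_one_iff, Subalgebra.mem_toSubmodule]
  constructor
  · rintro ⟨y, rfl⟩; exact y.2
  · intro hx; exact ⟨⟨x, hx⟩, rfl⟩

/-- The lattice of the principal ideal `(a)` is `(ℤ a) · 𝒪_c`. [folklore] -/
theorem fracIdealLattice_spanSingleton [NumberField K] (c : ℕ) [NeZero c] (a : K) :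
    fracIdealLattice c (FractionalIdeal.spanSingleton (quadOrder K c)⁰ a) =
      (ℤ ∙ a) * Subalgebra.toSubmodule (quadOrder K c) := by
  ext x
  rw [mem_fracIdealLattice_iff, FractionalIdeal.mem_spanSingleton, Submodule.mem_span_singleton_mul]
  constructor
  · rintro ⟨z, rfl⟩
    exact ⟨(z : K), z.2, by rw [Algebra.smul_def, mul_comm]; rfl⟩
  · rintro ⟨y, hy, rfl⟩
    exact ⟨⟨y, hy⟩, by rw [Algebra.smul_def, mul_comm]; rfl⟩

variable [NumberField K]

namespace GrossSpace

/-! ### Saturated points -/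

/-- A point `x = [(f, I)]` is **`𝒪_c`-saturated** if `𝒪_c • x = x`, i.e. `[(f, f(𝒪_c) I)] = x`:
the order `f(𝒪_c)` stabilises the lattice up to `Dˣ`. Gross points of conductor `c` are
saturated (`isSaturated_of_mem_grossPoints`), indeed so is every Gross point of conductor
dividing … of any order containing `f(𝒪_c)`. [folklore] -/
def IsSaturated (c : ℕ) (x : GrossSpace D K) : Prop :=
  Subalgebra.toSubmodule (quadOrder K c) • x = x

/-- A representative with `f(𝒪_c) I = I` gives a saturated point. [folklore] -/
theorem isSaturated_mk_of_eq (c : ℕ) {r : GrossRep D K}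
    (h : GrossRep.embLattice r.emb (Subalgebra.toSubmodule (quadOrder K c)) * r.lat = r.lat) :
    IsSaturated c (mk r) := by
  change mk _ = mk r
  congr 1
  ext : 1
  · rfl
  · exact h

/-- **Optimal embeddings give saturated points**: if `f(𝒪_c) ⊆ O_L(I)` (in particular if `f`
is optimal for `𝒪_c`), then `f(𝒪_c) I = I` and `[(f, I)]` is `𝒪_c`-saturated. [folklore] -/
theorem isSaturated_mk_of_forall_mem_leftOrder (c : ℕ) {r : GrossRep D K}
    (h : ∀ x : K, x ∈ quadOrder K c → r.emb x ∈ Brandt.leftOrder r.lat) :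
    IsSaturated c (mk r) := by
  refine isSaturated_mk_of_eq c (le_antisymm ?_ fun m hm => ?_)
  · rw [Submodule.mul_le]
    rintro _ ⟨a, ha, rfl⟩ m hm
    exact h a ha m hm
  · have h1 : r.emb 1 ∈ GrossRep.embLattice r.emb (Subalgebra.toSubmodule (quadOrder K c)) :=
      GrossRep.apply_mem_embLattice _ (Subalgebra.one_mem _)
    simpa using Submodule.mul_mem_mul h1 hm

variable {Nplus Nminus : ℕ} in
/-- Gross points of conductor `c` are `𝒪_c`-saturated. [folklore] -/
theorem isSaturated_of_mem_grossPoints {S : Brandt.XiSetup Nplus Nminus} {c : ℕ}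
    {x : GrossSpace S.D K} (hx : x ∈ grossPoints K S c) : IsSaturated c x := by
  obtain ⟨r, rfl, hr⟩ := hx
  exact isSaturated_mk_of_forall_mem_leftOrder c fun a ha => (hr.2 a).mpr ha

/-- Lattice translates by fractional `𝒪_c`-ideals are saturated (`𝒪_c 𝔞 = 𝔞`). [folklore] -/
theorem isSaturated_fracIdealLattice_smul (c : ℕ) (x : GrossSpace D K)
    (𝔞 : FractionalIdeal (quadOrder K c)⁰ K) : IsSaturated c (fracIdealLattice c 𝔞 • x) := by
  change _ • _ = _
  rw [← mul_smul, ← fracIdealLattice_one, ← fracIdealLattice_mul, one_mul]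

/-! ### The action of invertible fractional ideals and of `Pic(𝒪_c)` -/

open scoped Classical in
/-- The action of the group of **invertible fractional `𝒪_c`-ideals** on the Gross space:
`𝔞 • [(f, I)] = [(f, f(𝔞) I)]` on `𝒪_c`-saturated points (BD96 §2.3 (4)); on non-saturated points
the action is *defined* to be trivial (junk branch, making the action total and lawful; Gross
points are saturated, `isSaturated_of_mem_grossPoints`). [cite: BertoliniDarmon1996, §2.3 (4)] -/
instance fracIdealUnitsSMul (c : ℕ) :
    MulAction (FractionalIdeal (quadOrder K c)⁰ K)ˣ (GrossSpace D K) where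
  smul 𝔞 x := if IsSaturated c x then fracIdealLattice c (𝔞 : FractionalIdeal _ K) • x else x
  one_smul x := by
    change (if IsSaturated c x then _ else x) = x
    split_ifs with h
    · rw [Units.val_one, fracIdealLattice_one]; exact h
    · rfl
  mul_smul 𝔞 𝔟 x := by
    change (if IsSaturated c x then _ else x) =
      if IsSaturated c (if IsSaturated c x then _ else x) then
        fracIdealLattice c (𝔞 : FractionalIdeal _ K) • (if IsSaturated c x then _ else x)
      else (if IsSaturated c x then _ else x)
    by_cases h : IsSaturated c x
    · simp only [if_pos h, if_pos (isSaturated_fracIdealLattice_smul c x (𝔟 : FractionalIdeal _ K)),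
        Units.val_mul, fracIdealLattice_mul, mul_smul]
    · simp only [if_neg h]

/-- On a saturated point the unit ideal `𝔞` acts by the lattice `f(𝔞)`. [folklore] -/
theorem units_smul_of_isSaturated {c : ℕ} (𝔞 : (FractionalIdeal (quadOrder K c)⁰ K)ˣ)
    {x : GrossSpace D K} (hx : IsSaturated c x) :
    𝔞 • x = fracIdealLattice c (𝔞 : FractionalIdeal _ K) • x :=
  if_pos hx

/-- Off the saturated locus the action is trivial (junk branch). [folklore] -/
theorem units_smul_of_not_isSaturated {c : ℕ} (𝔞 : (FractionalIdeal (quadOrder K c)⁰ K)ˣ)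
    {x : GrossSpace D K} (hx : ¬ IsSaturated c x) : 𝔞 • x = x :=
  if_neg hx

/-- Saturation is preserved by the action. [folklore] -/
theorem IsSaturated.units_smul {c : ℕ} {x : GrossSpace D K} (hx : IsSaturated c x)
    (𝔞 : (FractionalIdeal (quadOrder K c)⁰ K)ˣ) : IsSaturated c (𝔞 • x) := by
  rw [units_smul_of_isSaturated 𝔞 hx]; exact isSaturated_fracIdealLattice_smul c x _

/-- The image of a unit of `K` under an embedding is a unit of `D`. [folklore] -/
def embUnit (f : K →ₐ[ℚ] D) (a : Kˣ) : Dˣ := Units.map (f : K →* D) a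

/-- `embUnit f a = f a` in `D`. [folklore] -/
@[simp] theorem val_embUnit (f : K →ₐ[ℚ] D) (a : Kˣ) : (embUnit f a : D) = f a := rfl

/-- `(embUnit f a)⁻¹ = f a⁻¹` in `D`. [folklore] -/
@[simp] theorem val_inv_embUnit (f : K →ₐ[ℚ] D) (a : Kˣ) :
    Units.val (embUnit f a)⁻¹ = f (Units.val a⁻¹) := rfl

/-- Conjugating `f` by `f(a)` does nothing (`K` is commutative). [folklore] -/
theorem unitConj_embUnit_comp (f : K →ₐ[ℚ] D) (a : Kˣ) : (unitConj (embUnit f a)).comp f = f := by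
  ext x
  change f a * f x * f (Units.val a⁻¹) = f x
  rw [← map_mul, ← map_mul, mul_comm (a : K) x, Units.mul_inv_cancel_right]

/-- The lattice translate by `(ℤ a) 𝔟` of `[(f, I)]` is that by `𝔟`: `[(f, f(a) Y)] = [(f, Y)]` via
the unit `f(a)`, which commutes with `f`. [folklore] -/
theorem span_singleton_mul_smul_mk (a : Kˣ) (𝔟 : Submodule ℤ K) (r : GrossRep D K) :
    ((ℤ ∙ (a : K)) * 𝔟) • mk r = 𝔟 • mk r := by
  rw [mul_smul, lattice_smul_mk, lattice_smul_mk, ← mk_units_smul (embUnit r.emb a) (𝔟 • r)]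
  congr 1
  ext : 1
  · simp only [GrossRep.lattice_smul_emb, GrossRep.units_smul_emb, unitConj_embUnit_comp]
  · simp only [GrossRep.lattice_smul_lat, GrossRep.units_smul_lat, GrossRep.lattice_smul_emb]
    rw [GrossRep.embLattice, Submodule.map_span, Set.image_singleton,
      Submodule.span_singleton_mul, Units.smul_def, val_embUnit]
    rfl

/-- **Principal ideals act trivially**: `(a) • x = x` for `a ∈ Kˣ`. [cite: BertoliniDarmon1996, §2.3 (4)] -/
theorem toPrincipalIdeal_smul (c : ℕ) [NeZero c] (a : Kˣ) (x : GrossSpace D K) :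
    (toPrincipalIdeal (quadOrder K c) K a : (FractionalIdeal (quadOrder K c)⁰ K)ˣ) • x = x := by
  by_cases hx : IsSaturated c x
  · rw [units_smul_of_isSaturated _ hx, coe_toPrincipalIdeal, fracIdealLattice_spanSingleton]
    induction x using ind with
    | h r => rw [span_singleton_mul_smul_mk]; exact hx
  · exact units_smul_of_not_isSaturated _ hx

/-- Every element of the subgroup of principal ideals acts trivially. [folklore] -/
theorem units_smul_eq_self_of_mem_range (c : ℕ) [NeZero c]
    {𝔞 : (FractionalIdeal (quadOrder K c)⁰ K)ˣ}
    (h𝔞 : 𝔞 ∈ (toPrincipalIdeal (quadOrder K c) K).range) (x : GrossSpace D K) : 𝔞 • x = x := by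
  obtain ⟨a, rfl⟩ := h𝔞
  exact toPrincipalIdeal_smul c a x

variable (D K) in
/-- The action of invertible fractional `𝒪_c`-ideals modulo principal ideals, as a homomorphism
to the permutations of the Gross space. [folklore] -/
def fracIdealQuotPermHom (c : ℕ) [NeZero c] :
    (FractionalIdeal (quadOrder K c)⁰ K)ˣ ⧸ (toPrincipalIdeal (quadOrder K c) K).range →*
      Equiv.Perm (GrossSpace D K) :=
  QuotientGroup.lift _ (MulAction.toPermHom _ (GrossSpace D K)) fun _ h𝔞 =>
    Equiv.ext fun x => units_smul_eq_self_of_mem_range c h𝔞 x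

variable (D K) in
/-- **The action of `Pic(𝒪_c)` on the Gross space** as a permutation representation
`ClassGroup (quadOrder K c) →* Perm (GrossSpace D K)`: Mathlib's class group (fractional ideals
in the abstract fraction field) is identified with invertible fractional ideals in `K` modulo
principal ones by `ClassGroup.equiv K`. [cite: BertoliniDarmon1996, §2.3 (4)] -/
def picardPermHom (c : ℕ) [NeZero c] : ClassGroup (quadOrder K c) →* Equiv.Perm (GrossSpace D K) :=
  (fracIdealQuotPermHom D K c).comp (ClassGroup.equiv K).toMonoidHom

/-- **The action of `Pic(𝒪_c)` on the Gross space** `GrossSpace D K` (BD96 §2.3 (4):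
`σ (g × f) = (g f̂(σ) × f)`), here `[𝔞] • [(f, I)] = [(f, f(𝔞) I)]` on `𝒪_c`-saturated points and
trivial elsewhere. [cite: BertoliniDarmon1996, §2.3 (4)] -/
instance picardMulAction (c : ℕ) [NeZero c] :
    MulAction (ClassGroup (quadOrder K c)) (GrossSpace D K) :=
  MulAction.compHom (GrossSpace D K) (picardPermHom D K c)

/-- Computation rule: the class of the invertible fractional ideal `𝔞 ⊆ K` acts as `𝔞` does. [folklore] -/
theorem picard_mk_smul (c : ℕ) [NeZero c] (𝔞 : (FractionalIdeal (quadOrder K c)⁰ K)ˣ)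
    (x : GrossSpace D K) : ClassGroup.mk K 𝔞 • x = 𝔞 • x := by
  change picardPermHom D K c (ClassGroup.mk K 𝔞) x = _
  rw [picardPermHom, MonoidHom.comp_apply, MulEquiv.coe_toMonoidHom, ClassGroup.equiv_mk,
    FractionalIdeal.canonicalEquiv_self]
  change fracIdealQuotPermHom D K c (QuotientGroup.mk' _ 𝔞) x = _
  simp [fracIdealQuotPermHom]

/-- **BD96 (4) on representatives**: for a saturated point `[(f, I)]` (e.g. a Gross point of
conductor `c`) and an invertible fractional `𝒪_c`-ideal `𝔞 ⊆ K`,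
`[𝔞] • [(f, I)] = [(f, f(𝔞) I)]`. [cite: BertoliniDarmon1996, §2.3 (4)] -/
theorem picard_mk_smul_mk (c : ℕ) [NeZero c] (𝔞 : (FractionalIdeal (quadOrder K c)⁰ K)ˣ)
    (r : GrossRep D K) (hr : IsSaturated c (mk r)) :
    ClassGroup.mk K 𝔞 • mk r =
      mk ⟨r.emb, GrossRep.embLattice r.emb (fracIdealLattice c (𝔞 : FractionalIdeal _ K)) * r.lat⟩ := by
  rw [picard_mk_smul, units_smul_of_isSaturated 𝔞 hr]
  rfl

/-- The `Pic(𝒪_c)`-action preserves saturation. [folklore] -/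
theorem IsSaturated.picard_smul {c : ℕ} [NeZero c] {x : GrossSpace D K} (hx : IsSaturated c x)
    (σ : ClassGroup (quadOrder K c)) : IsSaturated c (σ • x) := by
  refine ClassGroup.induction (K := K) (fun 𝔞 => ?_) σ
  rw [picard_mk_smul c 𝔞 x]
  exact hx.units_smul 𝔞

end GrossSpace

end Literature.NumberTheory.EllipticCurves

end
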